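import Literature.IUT.LogThetaLattice.LogWallRemarks
import Literature.IUT.LogThetaLattice.LogLinkIterates
import Literature.IUT.LogThetaLattice.FrobeniusPicture
import Literature.AnabelianGeometry.AbsoluteAnabelian.LocalVolumesNonarchimedeanProofs
import Mathlib.RingTheory.Valuation.ValuationSubring
import Mathlib.Analysis.SpecialFunctions.Exp
import HarnessLib

/-!
# [IUTchIII] §1, Remarks 1.1.1 (i), 1.2.2 (v)–(vii), 1.2.4 (i), 1.4.1 (i), 1.4.2 (ii): kernel junctions for
# the BLOCK D′ remark file `LogWallRemarks.lean` (proof-only companion: theorems only, no `def`, no named fact)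

Mochizuki, *Inter-universal Teichmüller theory III*, §1, kurims manuscript (May 2020) pp. 28–48, render
`paper:url-4b091feeb646` read on the page [claim: Mochizuki2012, status: disputed].  abc-iut cell, layer L6,
row «§1-REMARKS-COVERAGE» (seat abc-iut-L6-t9): the per-node clause-coverage census of the L6-t1-typed
[IUTchIII] §1 remark nodes cites kernel declarations BY NAME; this file supplies the few junctions that
were missing between abc-iut-L6-t1's abstract transcriptions (`unitsOnlyIterate`, `LogVolumeCommutative`,
`NotFromRingHom`, `Rmk141_notCommutative`) and the cell's MODELS of the same sentences
(abc-iut-L6-t3's `iterDomain` / `frobeniusPicture` / `logThetaLatticeGraph`, abc-iut-L4-t3/L4-t8's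
`localLogVolume`, the valuation-subring vocabulary of `LocalLogShells.lean`).

* §1 (Rmk 1.1.1 (i), p. 28 l. 31–49 "iterates of log-links … defined only on the [local] units"):
  `mem_iterDomain_iff_forall` (`D_n = {x : logᵏ x is a unit for all k < n}`) and the JUNCTION
  `unitsOnlyIterate_eq_some` / `unitsOnlyIterate_eq_none_iff` — L6-t1's partial iterate
  `unitsOnlyIterate` (convention typed as an `Option`-valued map) is `some (logⁿ x)` exactly on L6-t3's
  domain `iterDomain L n` (node of record, `LogLinkIterates.lean` p404701) and `none` off it.
* §2 (Rmk 1.2.2 (v), p. 37 l. 28–33 "commutative with respect to log-volumes … consistent with all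
  composites of the various arrows of `Γ⃗`"): `logVolumeCommutative_isometries` — L6-t1's predicate
  `LogVolumeCommutative` HOLDS for the genuine local log-volume `μ^log_k` ([AbsTopIII] Prop 5.7 (i),
  abc-iut-L4-t3) on the compact open sets `M(k)` and the arrows given by isometric additive automorphisms
  of `k` (the shape of every Kummer / poly-isomorphism arrow of `Γ⃗` on underlying additive modules), by
  abc-iut-L4-t8's `localLogVolume_image_of_isometry`; hence (`LogVolumeCommutative.comp_list`, L6-t1) for
  all composites.
* §3 (Rmk 1.2.4 (i), p. 39 l. 38–46 "the log-link … does not arise from a ring homomorphism"):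
  `notFromRingHom_iff_nontrivial` — the typed predicate `NotFromRingHom R₁ R₂ lg` is EQUIVALENT to
  `Nontrivial R₂` (for every homomorphism `lg` from the units to the additive group: `1 ↦ 0 ≠ 1`; over the
  zero ring the zero map is a ring homomorphism), which records honestly that the transcription captures
  the printed clause and nothing finer; `notFromRingHom_valuationSubring` — the genuine reading at
  `v ∈ V̲^non`: for a valued field `k`, ring of integers `𝒪_k` and ANY logarithm `log_k : 𝒪_k^× → k`
  (abc-iut-L6-t3's vocabulary `O : ValuationSubring k`, `logk : Additive (↥O)ˣ →+ k`, instantiated at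
  abc-iut-S1's `unitLog = log_p` by `exists_addMonoidHom_eq_unitLog`, p404729), no ring homomorphism
  `𝒪_k → k` restricts to `log_k` on `𝒪_k^×`.
* §4 (Rmk 1.2.2 (vi)(vii), p. 37 l. 36 – p. 38 l. 3 "quotient of the horizontal arrow portion of `Γ⃗` by
  the action of `ℤ` … an oriented copy of `S¹` … the horizontal arrow portion of `Γ⃗` may be thought of as
  a sort of unraveling of this oriented copy of `S¹`"; Rmk 1.4.2 (ii), p. 48 l. 10–14 "the horizontal
  lines of the log-theta-lattices … amount … to universal covering spaces of the loops"): the `ℤ`-action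
  `frobeniusPicture.translate` (L6-t3, Prop 1.2 (x)) is FREE AND TRANSITIVE on the spokes
  (`existsUnique_translate_spoke`) and on the horizontal arrows (`existsUnique_translate_arrow`): the
  quotient has one vertex and one loop, and the spoke chain is a `ℤ`-torsor over it (the combinatorial
  universal covering of the loop); the same for each horizontal line of `logThetaLatticeGraph`
  (`existsUnique_translate_horizontal`).
* §5 (Rmk 1.4.1 (i), p. 46 l. 20–30 "the various squares … are far from being [1-]commutative! …
  vertical arrows … logarithms … horizontal arrows … incompatible with these local ring structures"):
  `Rmk141_notCommutative_exp_pow` — L6-t1's predicate at the instance carrying the printed reason: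
  vertical arrow = the exponential/logarithm (interchanging `⊞` and `⊠`), horizontal arrow = an `N`-th
  power map, `N ≥ 2` (the `Θ`-links raise the `q`-parameter to the powers `j²`): `exp(x^N) ≠ exp(x)^N`
  at `x = 1`, so NO square commutes.  (abc-iut-w5-d117's `Rmk141_notCommutative_toy`, p413934, is the
  `ℤ`-valued shadow `x+1` / `2x`.)

HONEST FRAMING: junction lemmas between typed transcriptions of EXPOSITORY remarks and the cell's
models; nothing here identifies an object of [IUTchII]/[IUTchIII] with a model beyond what the cited
files state, and nothing bears on the disputed inequality of [IUTchIII] Cor. 3.12; no side is taken.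
typed ≠ proved elsewhere; covered ≠ endorsed.
-/

set_option autoImplicit false

noncomputable section

namespace Literature.IUT.LogThetaLattice

open Set Metric
open Literature.AnabelianGeometry.AbsoluteAnabelian

universe u

/-! ## §1. Rmk 1.1.1 (i): L6-t1's `unitsOnlyIterate` is L6-t3's `iterDomain` -/

section Iterates

variable {K : Type u} [NontriviallyNormedField K] (L : PadicLogOnUnits K)

/-- **IUTchIII:Rmk1.1.1(i)** (kurims p. 28 l. 31–35): closed form of abc-iut-L6-t3's recursive domain of
the `n`-th iterate of the log-link — `x ∈ D_n` iff `x, log x, …, logⁿ⁻¹ x` are all units ("defined only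
on the [local] units that appear in the domains of these log-links").
[claim: Mochizuki2012, status: disputed] (IUTchIII §1 Rmk 1.1.1 (i), kurims p.28) -/
theorem mem_iterDomain_iff_forall (n : ℕ) (x : K) :
    x ∈ iterDomain L n ↔ ∀ k < n, L.log^[k] x ∈ sphere (0 : K) 1 := by
  induction n generalizing x with
  | zero => simp
  | succ n ih =>
    rw [mem_iterDomain_succ, ih]
    constructor
    · rintro ⟨hx, h⟩ k hk
      rcases k with _ | k
      · simpa using hx
      · rw [Function.iterate_succ_apply]
        exact h k (by omega)
    · intro h
      refine ⟨by simpa using h 0 (by omega), fun k hk => ?_⟩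
      rw [← Function.iterate_succ_apply]
      exact h (k + 1) (by omega)

variable [DecidablePred fun x : K => x ∈ sphere (0 : K) 1]

/-- **IUTchIII:Rmk1.1.1(i)** (kurims p. 28), JUNCTION L6-t1 ↔ L6-t3: on L6-t3's domain `D_n` the
L6-t1 partial iterate `unitsOnlyIterate` (units-only convention, `Option`-valued) is DEFINED and equals
the `n`-th iterate `logⁿ x`. [claim: Mochizuki2012, status: disputed] (IUTchIII §1 Rmk 1.1.1 (i), kurims p.28) -/
theorem unitsOnlyIterate_eq_some {n : ℕ} {x : K} (hx : x ∈ iterDomain L n) :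
    unitsOnlyIterate (fun x : K => x ∈ sphere (0 : K) 1) (fun u => L.log u.1) n x
      = some (L.log^[n] x) := by
  induction n generalizing x with
  | zero => rfl
  | succ n ih =>
    have hxn : x ∈ iterDomain L n := iterDomain_succ_subset L n hx
    have hunit : L.log^[n] x ∈ sphere (0 : K) 1 :=
      (mem_iterDomain_iff_forall L (n + 1) x).mp hx n (Nat.lt_succ_self n)
    simp only [unitsOnlyIterate, ih hxn, dif_pos hunit, Function.iterate_succ_apply']

/-- **IUTchIII:Rmk1.1.1(i)** (kurims p. 28), JUNCTION L6-t1 ↔ L6-t3, converse: OFF L6-t3's domain `D_n`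
the L6-t1 partial iterate is UNDEFINED (`none`), and only there.
[claim: Mochizuki2012, status: disputed] (IUTchIII §1 Rmk 1.1.1 (i), kurims p.28) -/
theorem unitsOnlyIterate_eq_none_iff (n : ℕ) (x : K) :
    unitsOnlyIterate (fun x : K => x ∈ sphere (0 : K) 1) (fun u => L.log u.1) n x = none
      ↔ x ∉ iterDomain L n := by
  constructor
  · intro h hx
    rw [unitsOnlyIterate_eq_some L hx] at h
    exact Option.some_ne_none _ h
  · intro hx
    induction n generalizing x with
    | zero => exact absurd (mem_univ x) (by simp at hx)
    | succ n ih =>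
      by_cases hxn : x ∈ iterDomain L n
      · have hunit : L.log^[n] x ∉ sphere (0 : K) 1 := by
          intro hu
          apply hx
          rw [mem_iterDomain_iff_forall]
          intro k hk
          rcases Nat.lt_succ_iff_lt_or_eq.mp hk with hk | rfl
          · exact (mem_iterDomain_iff_forall L n x).mp hxn k hk
          · exact hu
        simp only [unitsOnlyIterate, unitsOnlyIterate_eq_some L hxn, dif_neg hunit]
      · simp only [unitsOnlyIterate, ih x hxn]

/-- **IUTchIII:Rmk1.1.1(i)** (kurims p. 28), the two readings agree: the L6-t1 iterate is defined at `x`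
iff `x ∈ D_n` (L6-t3). [claim: Mochizuki2012, status: disputed] (IUTchIII §1 Rmk 1.1.1 (i), kurims p.28) -/
theorem unitsOnlyIterate_isSome_iff (n : ℕ) (x : K) :
    (unitsOnlyIterate (fun x : K => x ∈ sphere (0 : K) 1) (fun u => L.log u.1) n x).isSome
      ↔ x ∈ iterDomain L n := by
  rw [Option.isSome_iff_ne_none, ne_eq, unitsOnlyIterate_eq_none_iff, not_not]

end Iterates

/-! ## §2. Rmk 1.2.2 (v): `LogVolumeCommutative` at the genuine local log-volume -/

section LogVolume

variable (K : Type u) [NontriviallyNormedField K] [IsUltrametricDist K] [ProperSpace K]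
  [MeasurableSpace K] [BorelSpace K]

/-- **IUTchIII:Rmk1.2.2(v)** (kurims p. 37 l. 28–33) at the genuine log-volume: L6-t1's predicate
`LogVolumeCommutative` holds for `μ^log_k` ([AbsTopIII] Prop 5.7 (i), abc-iut-L4-t3's `localLogVolume`)
on the nonempty compact open subsets `M(k)` of a nonarchimedean local field `k`, for the family of ALL
isometric additive automorphisms of `k` (abc-iut-L4-t8's `localLogVolume_image_of_isometry`: `μ^log` is
intrinsic).  With `LogVolumeCommutative.comp_list` (L6-t1) this is "consistent with all composites of
the various arrows". [claim: Mochizuki2012, status: disputed] (IUTchIII §1 Rmk 1.2.2 (v), kurims p.37) -/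
theorem logVolumeCommutative_isometries :
    LogVolumeCommutative
      (X := ↥(compactOpens K)) (ι := {e : K ≃+ K // Isometry e})
      (fun e A => ⟨e.1 '' (A : Set K), image_mem_compactOpens_of_isometry e.1 e.2 A.2⟩)
      (fun A => localLogVolume K (A : Set K)) :=
  fun e A => localLogVolume_image_of_isometry e.1 e.2 A.2

/-- **IUTchIII:Rmk1.2.2(v)** (kurims p. 37), composites: for every finite sequence of isometric additive
automorphisms of `k` and every `A ∈ M(k)`, the log-volume of the iterated image equals `μ^log_k(A)`.
[claim: Mochizuki2012, status: disputed] (IUTchIII §1 Rmk 1.2.2 (v), kurims p.37) -/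
theorem localLogVolume_foldr_isometries (l : List {e : K ≃+ K // Isometry e}) (A : ↥(compactOpens K)) :
    localLogVolume K
        ((l.foldr (fun e B => (⟨e.1 '' (B : Set K), image_mem_compactOpens_of_isometry e.1 e.2 B.2⟩ :
          ↥(compactOpens K))) A : ↥(compactOpens K)) : Set K)
      = localLogVolume K (A : Set K) :=
  (logVolumeCommutative_isometries K).comp_list l A

end LogVolume

/-! ## §3. Rmk 1.2.4 (i): the log-wall predicate `NotFromRingHom` -/

section LogWall

/-- **IUTchIII:Rmk1.2.4(i)** (kurims p. 39 l. 38–46), SHARP FORM of L6-t1's transcription: for EVERY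
homomorphism `lg` from the unit group of a ring `R₁` to the additive group of a ring `R₂`, "no ring
homomorphism `R₁ → R₂` restricts to `lg` on the units" holds iff `R₂` is not the zero ring (`lg 1 = 0`
while a ring homomorphism has `f 1 = 1`; over the zero ring the zero map is a ring homomorphism).
[claim: Mochizuki2012, status: disputed] (IUTchIII §1 Rmk 1.2.4 (i), kurims p.39) -/
theorem notFromRingHom_iff_nontrivial {R₁ R₂ : Type u} [Ring R₁] [Ring R₂]
    (lg : R₁ˣ →* Multiplicative R₂) : NotFromRingHom R₁ R₂ lg ↔ Nontrivial R₂ := by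
  constructor
  · intro h
    by_contra hnt
    haveI : Subsingleton R₂ := not_nontrivial_iff_subsingleton.mp hnt
    exact h ⟨{ toFun := fun _ => 0
               map_one' := Subsingleton.elim _ _
               map_mul' := fun _ _ => Subsingleton.elim _ _
               map_zero' := rfl
               map_add' := fun _ _ => Subsingleton.elim _ _ }, fun _ => Subsingleton.elim _ _⟩
  · intro _
    exact notFromRingHom_of_map_one lg

/-- **IUTchIII:Rmk1.2.4(i)** (kurims p. 39), the GENUINE reading at `v ∈ V̲^non` in the vocabulary of
`LocalLogShells.lean` (abc-iut-L6-t3): `k` a field with ring of integers `O` (a valuation subring) and ANY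
logarithm `log_k : 𝒪_k^× → k`, a homomorphism to the additive group (e.g. abc-iut-S1's `p_v`-adic
logarithm `unitLog`, packaged by `exists_addMonoidHom_eq_unitLog`, p404729): no ring homomorphism
`𝒪_k → k` restricts to `log_k` on `𝒪_k^×` — the "log-wall".
[claim: Mochizuki2012, status: disputed] (IUTchIII §1 Rmk 1.2.4 (i), kurims p.39) -/
theorem notFromRingHom_valuationSubring {k : Type u} [Field k] (O : ValuationSubring k)
    (logk : Additive (↥O)ˣ →+ k) :
    NotFromRingHom (↥O) k (AddMonoidHom.toMultiplicativeRight logk) :=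
  notFromRingHom_of_map_one _

/-- **IUTchIII:Rmk1.2.4(i)** (kurims p. 39), the same for the FIELD on both sides of the log-link
(print: "the ring structures of `Ψ^gp_{†ℱ_v}` and `Ψ^gp_{log(†ℱ_v)}`", both copies of `k̄_v` with `0`): no
ring endomorphism of a field `k` restricts on `k^×` to a homomorphism `k^× → (k, +)`.
[claim: Mochizuki2012, status: disputed] (IUTchIII §1 Rmk 1.2.4 (i), kurims p.39) -/
theorem notFromRingHom_field {k : Type u} [Field k] (lg : kˣ →* Multiplicative k) :
    NotFromRingHom k k lg :=
  notFromRingHom_of_map_one lg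

end LogWall

/-! ## §4. Rmk 1.2.2 (vi)(vii), Rmk 1.4.2 (ii): the horizontal line is a `ℤ`-torsor over one loop -/

section Torsor

open frobeniusPicture

/-- **IUTchIII:Rmk1.2.2(vi)** (kurims p. 37 l. 40 – p. 38 l. 3): the `ℤ`-action on the Frobenius-picture
(L6-t3's `frobeniusPicture.translate`, Prop 1.2 (x)) moves the spoke `•ₙ` to `•ₙ₊ₖ`.
[claim: Mochizuki2012, status: disputed] (IUTchIII §1 Rmk 1.2.2 (vi), kurims p.37) -/
theorem translate_spoke (k n : ℤ) : translate k (.spoke n) = .spoke (n + k) := rfl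

/-- **IUTchIII:Rmk1.2.2(vi)** (kurims p. 37 l. 40 – p. 38 l. 3) "quotient of the horizontal arrow portion
of `Γ⃗` by the action of `ℤ` … an oriented copy of `S¹` … the horizontal arrow portion … a sort of
unraveling of this oriented copy of `S¹`": the `ℤ`-action is FREE AND TRANSITIVE on the spokes — any
two spokes are related by exactly one translation — so the quotient has exactly one vertex and the spoke
set is a `ℤ`-torsor over it. [claim: Mochizuki2012, status: disputed] (IUTchIII §1 Rmk 1.2.2 (vi), kurims pp.37–38) -/
theorem existsUnique_translate_spoke (n m : ℤ) :
    ∃! k : ℤ, translate k (.spoke n) = .spoke m := by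
  refine ⟨m - n, ?_, fun k hk => ?_⟩
  · show FPVertex.spoke (n + (m - n)) = FPVertex.spoke m
    congr 1
    ring
  · have h : FPVertex.spoke (n + k) = FPVertex.spoke m := hk
    injection h with h
    omega

/-- **IUTchIII:Rmk1.2.2(vi)(vii)** (kurims pp. 37–38): … and on the horizontal ARROWS — every log-link
arrow `•ₙ → •ₙ₊₁` is the translate of `•₀ → •₁` by exactly one `k ∈ ℤ` (namely `k = n`), so the quotient
by `ℤ` has exactly one (loop) edge: the "oriented copy of `S¹`", whose "unraveling" (universal covering)
is the horizontal line. [claim: Mochizuki2012, status: disputed] (IUTchIII §1 Rmk 1.2.2 (vii), kurims p.38) -/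
theorem existsUnique_translate_arrow {n m : ℤ} (h : frobeniusPicture.Adj (.spoke n) (.spoke m)) :
    ∃! k : ℤ, translate k (.spoke 0) = .spoke n ∧ translate k (.spoke 1) = .spoke m := by
  rw [adj_spoke_spoke] at h
  subst h
  refine ⟨n, ⟨?_, ?_⟩, fun k hk => ?_⟩
  · show FPVertex.spoke (0 + n) = FPVertex.spoke n
    rw [zero_add]
  · show FPVertex.spoke (1 + n) = FPVertex.spoke (n + 1)
    rw [add_comm]
  · have h1 : FPVertex.spoke (0 + k) = FPVertex.spoke n := hk.1
    injection h1 with h1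
    omega

/-- **IUTchIII:Rmk1.2.2(vi)** (kurims p. 37): the `ℤ`-action FIXES the core `◦` and acts freely on
everything else — the coric vertex is the only vertex with a nontrivial stabiliser (indeed fixed by all
of `ℤ`: "the arithmetic holomorphic structure constituted by the coric `𝒟`-prime-strips is immune to
this juggling"). [claim: Mochizuki2012, status: disputed] (IUTchIII §1 Rmk 1.2.2 (vi), kurims p.37) -/
theorem translate_eq_self_iff (k : ℤ) (a : FPVertex) : translate k a = a ↔ a = .core ∨ k = 0 := by
  cases a with
  | core => simp
  | spoke n =>
    constructor
    · intro h
      have h' : FPVertex.spoke (n + k) = FPVertex.spoke n := h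
      injection h' with h'
      right
      omega
    · rintro (h | rfl)
      · exact absurd h (by simp)
      · exact translate_zero _

/-- **IUTchIII:Rmk1.4.2(ii)** (kurims p. 48 l. 10–14) "the horizontal lines of the log-theta-lattices …
amount, in effect, to universal covering spaces of the loops — i.e., unraveling paths of the loops":
in each horizontal line `m = const` of L6-t3's `logThetaLatticeGraph` (Def 1.4) the horizontal
translations act freely and transitively — any two vertices `(n, m)`, `(n', m)` are related by exactly
one horizontal translation `translate a 0`. [claim: Mochizuki2012, status: disputed] (IUTchIII §1 Rmk 1.4.2 (ii), kurims p.48) -/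
theorem existsUnique_translate_horizontal (n n' m : ℤ) :
    ∃! a : ℤ, logThetaLatticeGraph.translate a 0 (n, m) = (n', m) := by
  refine ⟨n' - n, ?_, fun a ha => ?_⟩
  · show ((n + (n' - n), m + 0) : ℤ × ℤ) = (n', m)
    ext <;> simp
  · have h : ((n + a, m + 0) : ℤ × ℤ) = (n', m) := ha
    have h1 := congrArg Prod.fst h
    simp only at h1
    omega

/-- **IUTchIII:Rmk1.4.2(ii)** / Thm 1.5 (ii) (kurims p. 48): every horizontal arrow `(n, m) → (n+1, m)` of
the lattice is the translate of `(0, m) → (1, m)` by exactly one horizontal translation.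
[claim: Mochizuki2012, status: disputed] (IUTchIII §1 Rmk 1.4.2 (ii), kurims p.48) -/
theorem existsUnique_translate_horizontal_arrow {n n' m : ℤ}
    (h : logThetaLatticeGraph.Adj (n, m) (n', m)) :
    ∃! a : ℤ, logThetaLatticeGraph.translate a 0 (0, m) = (n, m) ∧
      logThetaLatticeGraph.translate a 0 (1, m) = (n', m) := by
  rw [logThetaLatticeGraph_horizontal_line] at h
  subst h
  refine ⟨n, ⟨?_, ?_⟩, fun a ha => ?_⟩
  · show ((0 + n, m + 0) : ℤ × ℤ) = (n, m)
    ext <;> simp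
  · show ((1 + n, m + 0) : ℤ × ℤ) = (n + 1, m)
    ext <;> simp [add_comm]
  · have h1 := congrArg Prod.fst (show ((0 + a, m + 0) : ℤ × ℤ) = (n, m) from ha.1)
    simp only at h1
    omega

end Torsor

/-! ## §5. Rmk 1.4.1 (i): a non-commuting square with logarithmic vertical and power-map horizontal arrows -/

section Square

/-- **IUTchIII:Rmk1.4.1(i)** (kurims p. 46 l. 20–30) — L6-t1's `Rmk141_notCommutative` at the instance
that carries the printed REASON ("vertical arrows … logarithms … defined by means of power series that
depend … on the local ring structures … horizontal arrows … incompatible with these local ring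
structures"): on the constant lattice `X n m = ℝ`, vertical arrow `x ↦ exp x` (the exponential /
logarithm interchanging `⊞` and `⊠`), horizontal arrow `x ↦ x ^ N` with `2 ≤ N` (the `Θ`-links raise the
`q`-parameter to powers `j²`): NO square commutes, since `exp (1 ^ N) = e ≠ e ^ N = (exp 1) ^ N`.
[claim: Mochizuki2012, status: disputed] (IUTchIII §1 Rmk 1.4.1 (i), kurims p.46) -/
theorem Rmk141_notCommutative_exp_pow {N : ℕ} (hN : 2 ≤ N) :
    Rmk141_notCommutative (fun _ _ => ℝ) (fun _ _ x => Real.exp x) (fun _ _ x => x ^ N) := by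
  intro n m h
  have h1 : Real.exp ((1 : ℝ) ^ N) = Real.exp 1 ^ N := h 1
  rw [one_pow, ← Real.exp_nat_mul, mul_one, Real.exp_eq_exp] at h1
  have h2 : (N : ℝ) = 1 := h1.symm
  have h3 : N = 1 := by exact_mod_cast h2
  omega

/-- **IUTchIII:Rmk1.4.1(i)** (kurims p. 46), logarithmic form: vertical arrow `x ↦ log x` on the
positive reals (junk elsewhere), horizontal arrow `x ↦ x ^ N`, `2 ≤ N`: `log (x ^ N) = N·log x ≠ (log x) ^ N`
at `x = exp 1`, so no square commutes. [claim: Mochizuki2012, status: disputed] (IUTchIII §1 Rmk 1.4.1 (i), kurims p.46) -/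
theorem Rmk141_notCommutative_log_pow {N : ℕ} (hN : 2 ≤ N) :
    Rmk141_notCommutative (fun _ _ => ℝ) (fun _ _ x => Real.log x) (fun _ _ x => x ^ N) := by
  intro n m h
  have h1 : Real.log (Real.exp 1 ^ N) = Real.log (Real.exp 1) ^ N := h (Real.exp 1)
  rw [Real.log_pow, Real.log_exp, mul_one, one_pow] at h1
  have h3 : N = 1 := by exact_mod_cast h1
  omega

end Square

end Literature.IUT.LogThetaLattice

end
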